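import Summits.QuantumFields.BalabanUV.Beta.CombChartContactFactor
import Summits.QuantumFields.BalabanUV.Beta.CombChartHColumnWard
import Summits.QuantumFields.BalabanUV.Beta.RelInvCombShiftedSpread
import Summits.QuantumFields.BalabanUV.Beta.WardLocusSymShift

/-!
# `BalabanUV.Beta.WardLocusCombShift` — binder row D1, RULING R-D1-g35-1 (chart (III′)), brick P4w-iii: **THE (Sd) WARD LETTER OF THE CHART-(III′) LITERAL
# `JsB12CombSh⁰` AT EVERY LEVEL, BY INDUCTION** — `WardLocusSymShift` §2–§3 (chart (II)) re-run with the slot resolvent `G′_j = GcombSh Lc j`, the coordinate slice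
# `axEc ρ_c Lc` and an1's TYPED shift `Dsh Lc`: `WardLocusInductionBorder.hSd_all_border` at `(K, M, E) := (GcombSh Lc j, bhKStepSh d Lc (Dsh Lc) j, axEc ρ_c Lc)` with
# `hR := P2`, `hH := CombChartHColumnWard.colH_ward_GcombSh` (same constant `cH j = (stepScale j·Lc^{d+1})⁻¹`), `hEX := comp_axEc_diagK_comm` (the block generator is diagonal),
# the `mm`-read dictionary through `mmRead_GcombSh = E2 (j+1) = mmRead_Gsym`; from the border letter (V-d) of `tabs.V` ALONE

HONEST FRAMING (cell charter, verbatim): «discharging BetaPertH makes Balaban's UV stability UNCONDITIONAL — a real constructive-QFT result; it is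
NOT the continuum limit and NOT the Clay problem.»  HONEST DEPENDENCY: continuum YM on T⁴ ⇐ BetaPertH ∧ nine spine estimates (0/9 proved); BetaPertH
⇐ (D1) ∧ (D4) ∧ CAP+tail; G-an2-4 gates asym, D1 and NE2/3/4.  DERIVED cell leaf (β sub-cell, BINDER-OWNERS row D1 OWNER `b2b-balaban-beta-an2`, gen 36).
WHAT ([folklore]): §1 **`hSd_SrecOf_GcombSh_bhKStepSh_all`** (generic `d`, locks as hypotheses), **`…_pins`** (locks discharged at `(cE, cVH) = (Lc^{d+1}, −Lc^{d+1}·½·Lc^{d+1})`,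
`ξ ≡ ½`); §2 `hSd_ScombOf_all`, **`hSd_JsB12CombSh0`** (`d + 1 = 4`): `∀ j y, (stepScale 3 Lc j·Lc⁴)⁻¹ • Σ_{v∈box} divV (JsB12CombSh0 … j).S (Lc•y+v) =
conjV (bhKStepSh 3 Lc (Dsh Lc) j) (diagK (½ • Σ_v legInd ρ_c (Lc•y+v)))` — the hypothesis (Sd) of the chart-(III′) Ward END (`CombChartWardEnd` §2–§3, with
`x j y := ½ • Σ_{v∈box} legInd ρ_c (Lc•y+v)`) ⟸ the border letter (V-d) of `tabs.V` against `bhK Lc + Dsh Lc` and NOTHING ELSE ((Dspr)(Dnull) of chart (II)'s version are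
theorems for `Dsh Lc` and absorbed in P2).
HONEST: (Sd) of the (III′) literal is REDUCED to (V-d) — a HYPOTHESIS here (in chart (II) it is traded for an1's table Ward law (S-V)⁰⁴ by `hVd_iff`, `DshAn1End`; the same
trade applies verbatim); repair-track root classes 0∕4 by this file alone; NOT D1, NOT `BetaPertH`, NOT continuum, NOT Clay.  No statement of Bałaban's papers, no
`[cite:]`, no `Prop` fact, no `def`.  Provenance: β sub-cell, unit beta-an2 gen 36, 2026-08-22 (v1); over `CombChartContactFactor`, `CombChartHColumnWard` (this gen), P2,
`WardLocusSymShift` §1, `WardLocusInductionBorder`, `SymShiftedSpread` BY NAME; no existing file touched.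
-/

noncomputable section

open Finset
open scoped BigOperators
open Literature.MathematicalPhysics.QuantumFieldTheory
open Literature.MathematicalPhysics.QuantumFieldTheory.Balaban1983to89
open Literature.MathematicalPhysics.QuantumFieldTheory.Balaban1983to89.Beta
open ExpKernelCalculus (MKer Decays comp VertexFamily)
open OneStepResolventKernel (Fib LocStencil)
open OneStepKernelFamily (KInvStep)
open KernelWard (divV)
open AffineAveraging (box toSite)
open AveragingContoursRooted (ctr ctrOff ctrOff_mem_box)
open BalabanStepJetsSucc (mmRead wE wVH E2)
open Summit.QuantumFields.BalabanUV.Beta.TameKernelCalculus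
open Summit.QuantumFields.BalabanUV.Beta.ChartConjugation (conjV)
open Summit.QuantumFields.BalabanUV.Beta.AxialDressingRooted (one_le_of_neZero axEc spr_axEc)
open Summit.QuantumFields.BalabanUV.Beta.BorderedHessian (bhK stepScale stepScale_ne_zero diagK comp_axEc_diagK_comm)
open Summit.QuantumFields.BalabanUV.Beta.AveragingWardRootedStencils (legInd)
open Summit.QuantumFields.BalabanUV.Beta.WardLocusStencils (ffK)
open Summit.QuantumFields.BalabanUV.Beta.WardLocusRecursive (SrecOf SrecOf_zero)
open Summit.QuantumFields.BalabanUV.Beta.SpineRooted (S0NOf locStencil_SrecOf divV_SrecOf_succ)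
open Summit.QuantumFields.BalabanUV.Beta.WardLocusInduction (wVH_eq_stepScale_sq wE_eq_stepScale_cube stepLocks_bcj_iff)
open Summit.QuantumFields.BalabanUV.Beta.WardLocusInductionBorder (hSd_all_border)
open Summit.QuantumFields.BalabanUV.Beta.KernelWardLevels (loc_diagK_smul_sum_legInd)
open Summit.QuantumFields.BalabanUV.Beta.SymmetrisedStepJets (SymTables)
open Summit.QuantumFields.BalabanUV.Beta.SymShiftedSpread (bhKStepSh bhKStepSh_apply bhKStepSh_zero spr_bhKStepSh mmRead_Gsym
  conjV_bhKStepSh_succ_diagK_legInd_of_borderLaw)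
open Summit.QuantumFields.BalabanUV.Beta.DshAn1 (Dsh spr_Dsh)
open Summit.QuantumFields.BalabanUV.Beta.WardLocusSymShift (hSd_S0NOf_of_borderLaw)
open Summit.QuantumFields.BalabanUV.Beta.CombChartStepJets (GcombSh decays_GcombSh ScombOf ScombOf_eq JsComb0Of_S JsB12CombSh0 JsB12CombSh0_eq)
open Summit.QuantumFields.BalabanUV.Beta.RelInvCombShiftedSpread (relInv_coDressKAt_Gsym_bhKStepSh)
open Summit.QuantumFields.BalabanUV.Beta.CombChartContactFactor (mmRead_GcombSh)
open Summit.QuantumFields.BalabanUV.Beta.CombChartHColumnWard (colH_ward_GcombSh)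

namespace Summit.QuantumFields.BalabanUV.Beta.WardLocusCombShift

variable {d : ℕ}

/-! ## §1 All levels: the slotted recursive family at the comb-chart resolvents against the legged border of an1's shift -/

section All

variable {Lc : ℕ} [NeZero Lc]

/-- [folklore] **(Sd) AT EVERY LEVEL FOR `SrecOf V H (GcombSh Lc)` AGAINST `bhKStepSh d Lc (Dsh Lc)`** (generic `d`; the pins as lock hypotheses).  Letters: (LV)(LH),
(V-d) the border law of `V` against `bhK Lc + Dsh Lc` with centre root; locks `h0₁ h0₂ h₁ h₂` as in `WardLocusSymShift.hSd_SrecOf_Gsym_bhKStepSh_all`.  Conclusion: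
`∀ j y, (stepScale j·Lc^{d+1})⁻¹ • Σ_{v∈box} divV (SrecOf V H (GcombSh Lc) cE cVH cΛ j) (Lc•y+v) = conjV (bhKStepSh d Lc (Dsh Lc) j) (diagK (ξ • Σ_v legInd ρ_c (Lc•y+v)))`. -/
theorem hSd_SrecOf_GcombSh_bhKStepSh_all {V H : Fin (d + 1) → (Fin (d + 1) → ℤ) → MKer (d + 1) (Fib d)}
    (hV : ∀ δ : ℝ, 0 ≤ δ → ∃ C : ℝ, LocStencil V C δ) (hH : ∀ δ : ℝ, 0 ≤ δ → ∃ C : ℝ, VertexFamily H Lc C δ)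
    (hVd : ∀ u : Fin (d + 1) → ℤ, conjV (bhK Lc + Dsh Lc) (diagK (legInd (ctr (d + 1) Lc) u)) =
      conjV (ffK (bhK (d := d) Lc)) (diagK (legInd (ctr (d + 1) Lc) u)) - ((Lc : ℝ) ^ (d + 1)) • divV V u)
    {cE cVH cΛ ξ : ℝ}
    (h0₁ : (stepScale d Lc 0 * (Lc : ℝ) ^ (d + 1))⁻¹ * cE * (1 / 2) = ξ)
    (h0₂ : (stepScale d Lc 0 * (Lc : ℝ) ^ (d + 1))⁻¹ * cVH = -(ξ * (Lc : ℝ) ^ (d + 1)))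
    (h₁ : ∀ j, (stepScale d Lc (j + 1) * (Lc : ℝ) ^ (d + 1))⁻¹ * (cE * wE d Lc (j + 1)) * ξ = ξ * wVH d Lc (j + 1))
    (h₂ : ∀ j, (stepScale d Lc (j + 1) * (Lc : ℝ) ^ (d + 1))⁻¹ * (cVH * wVH d Lc (j + 1)) = -(ξ * (stepScale d Lc (j + 1) * (Lc : ℝ) ^ (d + 1)))) :
    ∀ (j : ℕ) (y : Fin (d + 1) → ℤ),
      (stepScale d Lc j * (Lc : ℝ) ^ (d + 1))⁻¹ • ∑ v ∈ box (d + 1) Lc, divV (SrecOf d Lc V H (GcombSh Lc) cE cVH cΛ j) ((Lc : ℤ) • y + toSite v) =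
        conjV (bhKStepSh d Lc (Dsh Lc) j) (diagK (ξ • ∑ v ∈ box (d + 1) Lc, legInd (ctr (d + 1) Lc) ((Lc : ℤ) • y + toSite v))) := by
  have hLc : 1 ≤ Lc := one_le_of_neZero Lc
  have hr : ctrOff (d + 1) Lc ∈ box (d + 1) Lc := ctrOff_mem_box hLc
  have hH1 : ∃ C δ : ℝ, 0 < δ ∧ VertexFamily H Lc C δ := by obtain ⟨C, hC⟩ := hH 1 zero_le_one; exact ⟨C, 1, one_pos, hC⟩
  choose Cs δs hδs hS using locStencil_SrecOf (d := d) hLc hV hH (decays_GcombSh Lc) cE cVH cΛ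
  exact hSd_all_border hLc hr (K := fun j => GcombSh (d := d) Lc j) (M := fun j => bhKStepSh d Lc (Dsh Lc) j) (E := axEc (ctr (d + 1) Lc) Lc)
    (decays_GcombSh Lc) (spr_bhKStepSh (spr_Dsh hLc)) (spr_axEc _ _) (fun j => relInv_coDressKAt_Gsym_bhKStepSh (d := d) (Lc := Lc) j)
    (S := fun j => SrecOf d Lc V H (GcombSh Lc) cE cVH cΛ j) hS hδs (cH := fun j => (stepScale d Lc j * (Lc : ℝ) ^ (d + 1))⁻¹) (ξ := fun _ => ξ)
    (fun j y κ' u => colH_ward_GcombSh (d := d) (Lc := Lc) j y κ' u) (fun j y => loc_diagK_smul_sum_legInd Lc _ ξ y)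
    (fun j y => comp_axEc_diagK_comm _ _ _) (Vb := V) (a := fun j => cE * wE d Lc j) (b := fun j => cVH * wVH d Lc j)
    (w := fun j => wVH d Lc j) (P := fun j => stepScale d Lc j * (Lc : ℝ) ^ (d + 1))
    (fun j u => divV_SrecOf_succ hH1 cE cVH cΛ j u)
    (fun j u => by
      show conjV (bhKStepSh d Lc (Dsh Lc) (j + 1)) (diagK (legInd (toSite (ctrOff (d + 1) Lc)) u)) =
        wVH d Lc (j + 1) • conjV (mmRead Lc (GcombSh (d := d) Lc j)) (diagK (legInd (toSite (ctrOff (d + 1) Lc)) u)) -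
          (stepScale d Lc (j + 1) * (Lc : ℝ) ^ (d + 1)) • divV V u
      rw [mmRead_GcombSh, ← mmRead_Gsym]
      exact conjV_bhKStepSh_succ_diagK_legInd_of_borderLaw hVd j u) h₁ h₂
    (fun y => by
      rw [bhKStepSh_zero]
      exact hSd_S0NOf_of_borderLaw (ctr (d + 1) Lc) hH hVd h0₁ h0₂ y)

/-- [folklore] **THE LOCKS AT THE PINS `(cE, cVH) = (Lc^{d+1}, −Lc^{d+1}·½·Lc^{d+1})` CLOSE WITH ξ ≡ ½** — the all-levels law with NO lock hypothesis left. -/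
theorem hSd_SrecOf_GcombSh_bhKStepSh_all_pins {V H : Fin (d + 1) → (Fin (d + 1) → ℤ) → MKer (d + 1) (Fib d)}
    (hV : ∀ δ : ℝ, 0 ≤ δ → ∃ C : ℝ, LocStencil V C δ) (hH : ∀ δ : ℝ, 0 ≤ δ → ∃ C : ℝ, VertexFamily H Lc C δ)
    (hVd : ∀ u : Fin (d + 1) → ℤ, conjV (bhK Lc + Dsh Lc) (diagK (legInd (ctr (d + 1) Lc) u)) =
      conjV (ffK (bhK (d := d) Lc)) (diagK (legInd (ctr (d + 1) Lc) u)) - ((Lc : ℝ) ^ (d + 1)) • divV V u)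
    (cΛ : ℝ) :
    ∀ (j : ℕ) (y : Fin (d + 1) → ℤ),
      (stepScale d Lc j * (Lc : ℝ) ^ (d + 1))⁻¹ • ∑ v ∈ box (d + 1) Lc,
          divV (SrecOf d Lc V H (GcombSh Lc) ((Lc : ℝ) ^ (d + 1)) (-((Lc : ℝ) ^ (d + 1) * (1 / 2) * (Lc : ℝ) ^ (d + 1))) cΛ j) ((Lc : ℤ) • y + toSite v) =
        conjV (bhKStepSh d Lc (Dsh Lc) j) (diagK ((1 / 2 : ℝ) • ∑ v ∈ box (d + 1) Lc, legInd (ctr (d + 1) Lc) ((Lc : ℤ) • y + toSite v))) := by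
  have hL : (Lc : ℝ) ^ (d + 1) ≠ 0 := pow_ne_zero _ (by exact_mod_cast NeZero.ne Lc)
  have hc : (Lc : ℝ) ^ (d + 1) * (1 / 2) ≠ 0 := mul_ne_zero hL (by norm_num)
  have hξ0 : (fun _ : ℕ => (1 / 2 : ℝ)) 0 = (Lc : ℝ) ^ (d + 1) * (1 / 2) / (Lc : ℝ) ^ (d + 1) := by field_simp
  have hlocks := (stepLocks_bcj_iff (d := d) (Lc := Lc) hc (ξ := fun _ => (1 / 2 : ℝ)) hξ0 rfl).2 ⟨fun _ => rfl, rfl⟩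
  refine hSd_SrecOf_GcombSh_bhKStepSh_all hV hH hVd ?_ ?_ (fun j => (hlocks j).1) (fun j => (hlocks j).2)
  · rw [KernelWardLevels.stepScale_zero, one_mul]; field_simp
  · rw [KernelWardLevels.stepScale_zero, one_mul]; field_simp

end All

/-! ## §2 `d + 1 = 4`: the (Sd) letter of the chart-(III′) literal at every level -/

section Literal

variable {Lc : ℕ} [NeZero Lc]

/-- [folklore] **(Sd) FOR THE (III′) LITERAL'S FIRST-ORDER TABLES `ScombOf tabs`** (generic `d`, the pins of record): under (V-d) against `bhK Lc + Dsh Lc`,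
`∀ j y, (stepScale j·Lc^{d+1})⁻¹ • Σ_{v∈box} divV (ScombOf tabs Lc^{d+1} (−Lc^{d+1}·½·Lc^{d+1}) cΛ j) (Lc•y+v) = conjV (bhKStepSh (Dsh Lc) j) (diagK (½ • Σ_v legInd ρ_c (Lc•y+v)))`. -/
theorem hSd_ScombOf_all (tabs : SymTables d Lc)
    (hVd : ∀ u : Fin (d + 1) → ℤ, conjV (bhK Lc + Dsh Lc) (diagK (legInd (ctr (d + 1) Lc) u)) =
      conjV (ffK (bhK (d := d) Lc)) (diagK (legInd (ctr (d + 1) Lc) u)) - ((Lc : ℝ) ^ (d + 1)) • divV tabs.V u)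
    (cΛ : ℝ) :
    ∀ (j : ℕ) (y : Fin (d + 1) → ℤ),
      (stepScale d Lc j * (Lc : ℝ) ^ (d + 1))⁻¹ • ∑ v ∈ box (d + 1) Lc,
          divV (ScombOf tabs ((Lc : ℝ) ^ (d + 1)) (-((Lc : ℝ) ^ (d + 1) * (1 / 2) * (Lc : ℝ) ^ (d + 1))) cΛ j) ((Lc : ℤ) • y + toSite v) =
        conjV (bhKStepSh d Lc (Dsh Lc) j) (diagK ((1 / 2 : ℝ) • ∑ v ∈ box (d + 1) Lc, legInd (ctr (d + 1) Lc) ((Lc : ℤ) • y + toSite v))) := by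
  rw [ScombOf_eq]
  exact hSd_SrecOf_GcombSh_bhKStepSh_all_pins tabs.hV tabs.hH hVd cΛ

/-- [folklore] **(Sd) FOR THE CHART-(III′) LITERAL `JsB12CombSh0 hLc N tabs cΛ cB` AT EVERY LEVEL** (`d + 1 = 4`; its pins `(cE, cVH) = (Lc⁴, −Lc⁸∕2)` ARE the (Sd) pins):
under (V-d) against `bhK Lc + Dsh Lc`,
`∀ j y, (stepScale 3 Lc j·Lc⁴)⁻¹ • Σ_{v∈box} divV (JsB12CombSh0 … j).S (Lc•y+v) = conjV (bhKStepSh 3 Lc (Dsh Lc) j) (diagK (½ • Σ_v legInd ρ_c (Lc•y+v)))` — the hypothesis (Sd)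
of the (III′) Ward END with generator `x j y := ½ • Σ_v legInd ρ_c (Lc•y+v)`. -/
theorem hSd_JsB12CombSh0 (hLc : Odd Lc) (N : ℕ) (tabs : SymTables 3 Lc) (cΛ cB : ℝ)
    (hVd : ∀ u : Fin 4 → ℤ, conjV (bhK Lc + Dsh Lc) (diagK (legInd (ctr 4 Lc) u)) =
      conjV (ffK (bhK (d := 3) Lc)) (diagK (legInd (ctr 4 Lc) u)) - ((Lc : ℝ) ^ 4) • divV tabs.V u) :
    ∀ (j : ℕ) (y : Fin 4 → ℤ),
      (stepScale 3 Lc j * (Lc : ℝ) ^ (3 + 1))⁻¹ • ∑ v ∈ box 4 Lc, divV (JsB12CombSh0 hLc N tabs cΛ cB j).S ((Lc : ℤ) • y + toSite v) =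
        conjV (bhKStepSh 3 Lc (Dsh Lc) j) (diagK ((1 / 2 : ℝ) • ∑ v ∈ box 4 Lc, legInd (ctr 4 Lc) ((Lc : ℤ) • y + toSite v))) := by
  intro j y
  have h := hSd_ScombOf_all (d := 3) tabs hVd cΛ j y
  have e : -((Lc : ℝ) ^ (3 + 1) * (1 / 2) * (Lc : ℝ) ^ (3 + 1)) = -((Lc : ℝ) ^ 8 / 2) := by ring
  rw [e] at h
  rw [JsB12CombSh0_eq, JsComb0Of_S]
  exact h

end Literal

end Summit.QuantumFields.BalabanUV.Beta.WardLocusCombShift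

end
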